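import Summits.CriticalPhenomena.PercolationContinuityZ3.Theorems.PercNearOneGluingNoHeavyLowerTailSahiCombStrata
import Summits.CriticalPhenomena.PercolationContinuityZ3.Theorems.SahiMasterFamilyLowerResidualStep

/-!
# The comb (tensor-Bernstein) hierarchy for Sahi's `E_k`, IV: DECREASING events (the percolation separations) — reflection
# `p ↦ 1 − p` of certificates, `(M⁺-k) for down-sets ↔ (M⁺-k)`, and (M⁺-3) off the residual class for decreasing triples

Support file of the one-cut programme (crux `NoHeavyLowerTail`, stmt-CriticalPhenomena-4575; cell `prim-masterthm`, seat P3;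
HIERARCHY.md §9).  The one-cut rows (E3GRP, the four- and five-terminal separation dictionaries of HIERARCHY §4) are `E_k` of group
SEPARATIONS `D[X|Y]`, which are decreasing events.  `SahiMasterFamilyLowerTransfer` (unit p4) moves the law-level statements across by
complementing configurations, `E_k(μ_p; 1_D) = E_k(μ_{1−p}; 1_{compl⁻¹' D})`.  At the comb level the same map REFLECTS the tensor-Bernstein
basis, `b^c_j(1 − p) = b^c_{c−j}(p)`, so a certificate of multidegree `c` for `p ↦ F(1−p)` is a certificate for `F` with the coefficient
array reversed (`CombPos.reflect`).  Consequences: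
* `MasterFamilyCombPosLower k` — (M⁺-k) for `k` DECREASING events — and `masterFamilyCombPosLower_iff : … ↔ MasterFamilyCombPos k`
  (every `k`); hence (M⁺-2) for down-sets (`masterFamilyCombPosLower_two`);
* `combPos_sahiE_three_lower_of_not_residual` — (M⁺-3) for three decreasing events with a comparable pair, OR a co-cylinder member
  `{ω | Disjoint ω S}` ("all coordinates of `S` closed", e.g. "terminal `b` isolated"), OR a member independent of the other two, OR the
  other two determined by disjoint coordinate sets, OR a member containing the intersection of the other two — unconditionally.
HONEST FRAMING: nothing here asserts (M⁺-k) or `C_k` for `k ≥ 3`. [this work]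
-/

noncomputable section

open scoped Classical unitInterval

namespace Summit.CriticalPhenomena.PercolationContinuityZ3.Theorems

open Finset Function
open Literature.Combinatorics.Sahi2008
open Literature.Probability.LatticeModels (isUpperSet_preimage_compl isLowerSet_preimage_compl)
open Literature.Probability.Percolation (DeterminedBy determinedBy_iff)
open Literature.Probability.Percolation.DecisionTree (ind ind_of_mem ind_of_not_mem ind_nonneg)
open SahiComb

namespace SahiComb

variable {ι : Type*} [Fintype ι]

/-- Reflecting the parameters reflects the basis: `b^c_j(1 − p) = b^c_{c − j}(p)` for `j ≤ c`. [folklore] -/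
theorem bern_symm {c j : ι → ℕ} (hj : j ∈ box c) (p : ι → unitInterval) :
    bern c j (fun e => σ (p e)) = bern c (c - j) p := by
  unfold bern
  refine prod_congr rfl fun e _ => ?_
  have hje : j e ≤ c e := mem_box.1 hj e
  have h1 : c e - (c - j) e = j e := by simp only [Pi.sub_apply]; omega
  rw [h1, Pi.sub_apply, unitInterval.coe_symm_eq, sub_sub_cancel, mul_comm]

/-- **Reflection of certificates**: if `p ↦ F(1 − p)` is comb-positive at multidegree `c` then so is `F` (reverse the coefficient
array, `j ↦ c − j`). [this work] -/
theorem CombPos.of_reflect {c : ι → ℕ} {F : (ι → unitInterval) → ℝ} (h : CombPos c (fun p => F (fun e => σ (p e)))) :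
    CombPos c F := by
  obtain ⟨N, hN, hF⟩ := h
  refine ⟨fun j => N (c - j), fun j => hN _, fun p => ?_⟩
  have h1 := hF (fun e => σ (p e))
  simp only [unitInterval.symm_symm] at h1
  rw [h1]
  -- reindex by the involution `j ↦ c − j` of the box
  have hinv : ∀ j ∈ box c, c - (c - j) = j := fun j hj => by
    funext e; have := mem_box.1 hj e; simp only [Pi.sub_apply]; omega
  have hmem : ∀ j ∈ box c, c - j ∈ box c := fun j _ => mem_box.2 fun e => by simp only [Pi.sub_apply]; omega
  refine sum_nbij' (fun j => c - j) (fun j => c - j) hmem hmem hinv hinv fun j hj => ?_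
  rw [bern_symm hj]
  dsimp only
  rw [hinv j hj]

/-- Reflection of certificates, forward form: `CombPos c F → CombPos c (p ↦ F(1 − p))`. [this work] -/
theorem CombPos.reflect {c : ι → ℕ} {F : (ι → unitInterval) → ℝ} (h : CombPos c F) :
    CombPos c (fun p => F (fun e => σ (p e))) :=
  CombPos.of_reflect (F := fun p => F (fun e => σ (p e))) (h.congr fun p => by simp)

end SahiComb

/-! ### (M⁺-k) for decreasing events -/

/-- **(M⁺-k) for DECREASING events**: for every finite `ι` and all decreasing `D_0,…,D_{k−1} ⊆ 2^ι`, `p ↦ E_k(μ_p; 1_D)` is comb-positive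
at multidegree `k`.  Equivalent to `MasterFamilyCombPos k` (`masterFamilyCombPosLower_iff`); THEOREM for `k ≤ 2`, OPEN for `k ≥ 3`.
An obligation, never a fact. [this work] [status: open for k ≥ 3] -/
@[conjecture] def MasterFamilyCombPosLower (k : ℕ) : Prop :=
  ∀ (ι : Type) [Fintype ι] (D : Fin k → Set (Set ι)), (∀ j, IsLowerSet (D j)) →
    CombPos (fun _ : ι => k) (fun p => sahiE (bernoulliWeight p) k (fun j => ind (D j)))

/-- **`MasterFamilyCombPosLower k ↔ MasterFamilyCombPos k`** (every `k`): complement the configurations and reflect the parameters.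
[this work] -/
theorem masterFamilyCombPosLower_iff (k : ℕ) : MasterFamilyCombPosLower k ↔ MasterFamilyCombPos k := by
  constructor
  · intro h ι _ U hU
    have h1 := (h ι (fun j => compl ⁻¹' U j) fun j => isLowerSet_preimage_compl (hU j)).reflect
    exact h1.congr fun p => sahiE_ind_eq_sahiE_ind_preimage_compl p U
  · intro h ι _ D hD
    have h1 := (h ι (fun j => compl ⁻¹' D j) fun j => isUpperSet_preimage_compl (hD j)).reflect
    exact h1.congr fun p => sahiE_ind_eq_sahiE_ind_preimage_compl p D

/-- (M⁺-k) for decreasing events ⇒ `C_k` on product measures for decreasing events. [this work] -/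
theorem masterFamilyCombPosLower_le_masterFamilyNonnegLower (k : ℕ) : MasterFamilyCombPosLower k → MasterFamilyNonnegLower k :=
  fun h ι _ p D hD => (h ι D hD).nonneg p

/-- **(M⁺-2) for decreasing events** (the covariance of two down-sets is comb-positive at multidegree 2). [this work] -/
theorem masterFamilyCombPosLower_two : MasterFamilyCombPosLower 2 :=
  (masterFamilyCombPosLower_iff 2).2 masterFamilyCombPos_two

/-- (M⁺-k) for decreasing events holds for `k ≤ 2`. [this work] -/
theorem masterFamilyCombPosLower_of_le_two {k : ℕ} (hk : k ≤ 2) : MasterFamilyCombPosLower k :=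
  (masterFamilyCombPosLower_iff k).2 (masterFamilyCombPos_of_le_two hk)

/-! ### (M⁺-3) off the residual class for decreasing triples -/

section Lower

variable {ι : Type} [Fintype ι]

omit [Fintype ι] in
/-- Complementing configurations preserves "a member contains the intersection of the others". [folklore] -/
theorem preimage_compl_totalMeet {k : ℕ} {D : Fin (k + 3) → Set (Set ι)} {m : Fin (k + 3)}
    (hmeet : (⋂ j, D (m.succAbove j)) ⊆ D m) :
    (⋂ j, compl ⁻¹' D (m.succAbove j)) ⊆ compl ⁻¹' D m := by
  rw [← Set.preimage_iInter]
  exact Set.preimage_mono hmeet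

/-- **(M⁺-3) OFF THE RESIDUAL CLASS, DECREASING events, unconditionally.**  Three decreasing events of a finite cube with (R4) a comparable
pair, OR (R5) a co-cylinder member `{ω | Disjoint ω S}` (all coordinates of `S` closed), OR (R3) a member determined by `F` while the
other two are determined by `Fᶜ`, OR (R6) the other two members determined by disjoint coordinate sets, OR (R7′) a member containing
the intersection of the other two, have `p ↦ E_3(μ_p; 1_{D_0},1_{D_1},1_{D_2})` comb-positive at multidegree `3`. [this work] -/
theorem combPos_sahiE_three_lower_of_not_residual (D : Fin 3 → Set (Set ι)) (hD : ∀ j, IsLowerSet (D j))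
    (h : (∃ i j : Fin 3, j ≠ i ∧ D j ⊆ D i) ∨ (∃ (m : Fin 3) (S : Set ι), D m = {ω : Set ι | Disjoint ω S}) ∨
      (∃ (m : Fin 3) (F : Finset ι), DeterminedBy (D m) (↑F : Set ι) ∧ ∀ j, DeterminedBy (D (m.succAbove j)) (↑F : Set ι)ᶜ) ∨
      (∃ m : Fin 3, SuppZeroFlag 2 (fun j => D (m.succAbove j))) ∨
      (∃ m : Fin 3, (⋂ j, D (m.succAbove j)) ⊆ D m)) :
    CombPos (fun _ : ι => 3) (fun p => sahiE (bernoulliWeight p) 3 (fun j => ind (D j))) := by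
  have hU : ∀ j, IsUpperSet (compl ⁻¹' D j) := fun j => isUpperSet_preimage_compl (hD j)
  have hstrata : (∃ i j : Fin 3, j ≠ i ∧ compl ⁻¹' D j ⊆ compl ⁻¹' D i) ∨
      (∃ (m : Fin 3) (S : Set ι), compl ⁻¹' D m = {ω : Set ι | S ⊆ ω}) ∨
      (∃ (m : Fin 3) (F : Finset ι), DeterminedBy (compl ⁻¹' D m) (↑F : Set ι) ∧
        ∀ j, DeterminedBy (compl ⁻¹' D (m.succAbove j)) (↑F : Set ι)ᶜ) ∨
      (∃ m : Fin 3, SuppZeroFlag 2 (fun j => compl ⁻¹' D (m.succAbove j))) ∨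
      (∃ m : Fin 3, (⋂ j, compl ⁻¹' D (m.succAbove j)) ⊆ compl ⁻¹' D m) := by
    rcases h with h4 | h4 | h4 | h4 | ⟨m, hmeet⟩
    · rcases strata_preimage_compl (k := 0) (Or.inl h4) with h' | h' | h' | h'
      · exact Or.inl h'
      · exact Or.inr (Or.inl h')
      · exact Or.inr (Or.inr (Or.inl h'))
      · exact Or.inr (Or.inr (Or.inr (Or.inl h')))
    · rcases strata_preimage_compl (k := 0) (Or.inr (Or.inl h4)) with h' | h' | h' | h'
      · exact Or.inl h'
      · exact Or.inr (Or.inl h')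
      · exact Or.inr (Or.inr (Or.inl h'))
      · exact Or.inr (Or.inr (Or.inr (Or.inl h')))
    · rcases strata_preimage_compl (k := 0) (Or.inr (Or.inr (Or.inl h4))) with h' | h' | h' | h'
      · exact Or.inl h'
      · exact Or.inr (Or.inl h')
      · exact Or.inr (Or.inr (Or.inl h'))
      · exact Or.inr (Or.inr (Or.inr (Or.inl h')))
    · rcases strata_preimage_compl (k := 0) (Or.inr (Or.inr (Or.inr h4))) with h' | h' | h' | h'
      · exact Or.inl h'
      · exact Or.inr (Or.inl h')
      · exact Or.inr (Or.inr (Or.inl h'))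
      · exact Or.inr (Or.inr (Or.inr (Or.inl h')))
    · exact Or.inr (Or.inr (Or.inr (Or.inr ⟨m, preimage_compl_totalMeet hmeet⟩)))
  have h1 := (combPos_sahiE_three_of_not_residual (fun j => compl ⁻¹' D j) hU hstrata).reflect
  exact h1.congr fun p => sahiE_ind_eq_sahiE_ind_preimage_compl p D

/-- Law-level corollary: `E_3(μ_p; 1_D) ≥ 0` for decreasing triples on the five strata, every `p ∈ [0,1]^ι`. [this work] -/
theorem sahiE_three_ind_lower_nonneg_of_not_residual_comb (p : ι → unitInterval) (D : Fin 3 → Set (Set ι))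
    (hD : ∀ j, IsLowerSet (D j))
    (h : (∃ i j : Fin 3, j ≠ i ∧ D j ⊆ D i) ∨ (∃ (m : Fin 3) (S : Set ι), D m = {ω : Set ι | Disjoint ω S}) ∨
      (∃ (m : Fin 3) (F : Finset ι), DeterminedBy (D m) (↑F : Set ι) ∧ ∀ j, DeterminedBy (D (m.succAbove j)) (↑F : Set ι)ᶜ) ∨
      (∃ m : Fin 3, SuppZeroFlag 2 (fun j => D (m.succAbove j))) ∨
      (∃ m : Fin 3, (⋂ j, D (m.succAbove j)) ⊆ D m)) :
    0 ≤ sahiE (bernoulliWeight p) 3 (fun j => ind (D j)) :=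
  (combPos_sahiE_three_lower_of_not_residual D hD h).nonneg p

/-- **The comb-level `k → k+1` step off the residual class for DECREASING events, every `k`** (four strata: comparable pair,
independent member, zero-flag deleted family, total-meet member), GIVEN (M⁺-j) for all `j ≤ k + 2`. [this work] -/
theorem combPos_sahiE_ind_lower_of_not_residual {k : ℕ} (hN : ∀ j, j ≤ k + 2 → MasterFamilyCombPos j)
    (D : Fin (k + 3) → Set (Set ι)) (hD : ∀ j, IsLowerSet (D j))
    (h : (∃ i j : Fin (k + 3), j ≠ i ∧ D j ⊆ D i) ∨
      (∃ (m : Fin (k + 3)) (F : Finset ι), DeterminedBy (D m) (↑F : Set ι) ∧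
        ∀ j, DeterminedBy (D (m.succAbove j)) (↑F : Set ι)ᶜ) ∨
      (∃ m : Fin (k + 3), SuppZeroFlag (k + 2) (fun j => D (m.succAbove j))) ∨
      (∃ m : Fin (k + 3), (⋂ j, D (m.succAbove j)) ⊆ D m)) :
    CombPos (fun _ : ι => k + 3) (fun p => sahiE (bernoulliWeight p) (k + 3) (fun j => ind (D j))) := by
  have hU : ∀ j, IsUpperSet (compl ⁻¹' D j) := fun j => isUpperSet_preimage_compl (hD j)
  have hstrata : (∃ i j : Fin (k + 3), j ≠ i ∧ compl ⁻¹' D j ⊆ compl ⁻¹' D i) ∨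
      (∃ (m : Fin (k + 3)) (F : Finset ι), DeterminedBy (compl ⁻¹' D m) (↑F : Set ι) ∧
        ∀ j, DeterminedBy (compl ⁻¹' D (m.succAbove j)) (↑F : Set ι)ᶜ) ∨
      (∃ m : Fin (k + 3), SuppZeroFlag (k + 2) (fun j => compl ⁻¹' D (m.succAbove j))) ∨
      (∃ m : Fin (k + 3), (⋂ j, compl ⁻¹' D (m.succAbove j)) ⊆ compl ⁻¹' D m) := by
    rcases h with ⟨i, j, hij, hsub⟩ | ⟨m, F, hF, hFc⟩ | ⟨m, hZ⟩ | ⟨m, hmeet⟩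
    · exact Or.inl ⟨i, j, hij, Set.preimage_mono hsub⟩
    · exact Or.inr (Or.inl ⟨m, F, (determinedBy_preimage_compl_iff _ _).2 hF,
        fun j => (determinedBy_preimage_compl_iff _ _).2 (hFc j)⟩)
    · exact Or.inr (Or.inr (Or.inl ⟨m, (suppZeroFlag_preimage_compl_iff (k + 2) _).2 hZ⟩))
    · exact Or.inr (Or.inr (Or.inr ⟨m, preimage_compl_totalMeet hmeet⟩))
  have h1 := (combPos_sahiE_ind_of_not_residual hN (fun j => compl ⁻¹' D j) hU hstrata).reflect
  exact h1.congr fun p => sahiE_ind_eq_sahiE_ind_preimage_compl p D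

end Lower

end Summit.CriticalPhenomena.PercolationContinuityZ3.Theorems
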